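import Mathlib
import Literature.Computability.AlgebraicComplexity.XyzFreeDiagonal
import Literature.Computability.AlgebraicComplexity.XyzFreeDiagonalProofs
import Summits.MatrixMultiplication.MatrixMultiplication.Theorems.SoloInformedCwTwoBorderSumFree
import Summits.MatrixMultiplication.MatrixMultiplication.Theorems.SoloInformedCwTwoBoundedExponent

/-!
# Door D6 is closed in bounded exponent — unconditional form

`SoloInformedCwTwoBoundedExponent.lean` proved, CONDITIONALLY on the named Literature fact
`XyzFreeDiagonalHypothesis` (Strassen's free diagonal of `S₁^K` of size `(3-η)^{|K|}`), that weighted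
digit designs ("door D6" of `SoloInformedCwTwoMonomialDoor.lean`) in abelian hosts of bounded
exponent `ℓ` satisfy `3^N ≤ |B|^{1-δ(ℓ)}`, hence can never reach `|B| ≤ (3+ε)^N` for small `ε`.
The fact has since been PROVED in the tree (`XyzFreeDiagonalHypothesis_holds`, file
`Literature/Computability/AlgebraicComplexity/XyzFreeDiagonalProofs.lean`, via the
Bürgisser–Clausen–Shokrollahi hashing theorem `BCS1997_thm1539_free`, the Salem–Spencer diagonal and
Behrend's bound). This file records the two UNCONDITIONAL corollaries, with the hypothesis supplied.

Consequently the only hosts in which door D6 can still be open at rate `3+ε` are those of unbounded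
exponent (e.g. cyclic or `ℤ/Mℤ`-like hosts), in line with the integer / nested-radix evidence of the
accompanying notes.
-/

namespace Summit.MatrixMultiplication.MatrixMultiplication.Theorems

open Literature.Computability.AlgebraicComplexity

/-- **Door D6, bounded exponent, unconditional.** For every exponent bound `ℓ` there is `δ > 0`
such that every weighted digit design (`IsDoorDesign f a`) on `N` coordinates in a finite abelian
group `B` with `AddMonoid.exponent B ≤ ℓ` has `3^N ≤ |B|^{1-δ}`. (The conditional theorem
`three_pow_le_card_rpow_of_design` with Strassen's free-diagonal theorem
`XyzFreeDiagonalHypothesis_holds` plugged in.) -/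
theorem three_pow_le_card_rpow_of_design_unconditional (ℓ : ℕ) :
    ∃ δ : ℝ, 0 < δ ∧ ∀ (N : ℕ) (B : Type) [AddCommGroup B] [Fintype B]
      (f : Fin N → Fin 3 → B) (a : Fin N → Fin 3 → ℕ),
      AddMonoid.exponent B ≤ ℓ → IsDoorDesign f a →
        (3 : ℝ) ^ N ≤ (Fintype.card B : ℝ) ^ (1 - δ) :=
  three_pow_le_card_rpow_of_design XyzFreeDiagonalHypothesis_holds ℓ

/-- **No near-extremal weighted digit designs in bounded exponent, unconditional.** For every `ℓ`
it is NOT the case that for every `ε > 0` there is a weighted digit design (door-D6 hypothesis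
verbatim, as in `SoloInformedCwTwoMonomialDoor`) on `N ≥ 1` coordinates in a host of exponent `≤ ℓ`
with `|B| ≤ (3+ε)^N`. (The conditional theorem `not_weighted_designs_of_bounded_exponent` with
`XyzFreeDiagonalHypothesis_holds` plugged in.) -/
theorem not_weighted_designs_of_bounded_exponent_unconditional (ℓ : ℕ) :
    ¬ ∀ ε : ℝ, 0 < ε → ∃ (N : ℕ) (B : Type) (_ : AddCommGroup B) (_ : Fintype B)
      (_ : DecidableEq B) (f : Fin N → Fin 3 → B) (a : Fin N → Fin 3 → ℕ), 0 < N ∧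
      AddMonoid.exponent B ≤ ℓ ∧
      (∀ u v w : Fin N → Fin 3,
        wordSum f u + wordSum f v + wordSum f w = ∑ k, (f k 0 + f k 1 + f k 2) →
          (∀ k, u k ≠ v k ∧ u k ≠ w k ∧ v k ≠ w k) ∨
            ∑ k, (a k 0 + a k 1 + a k 2) < wordWt a u + wordWt a v + wordWt a w) ∧
      (Fintype.card B : ℝ) ≤ (3 + ε) ^ N :=
  not_weighted_designs_of_bounded_exponent XyzFreeDiagonalHypothesis_holds ℓ

end Summit.MatrixMultiplication.MatrixMultiplication.Theorems
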